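import Mathlib.Geometry.Manifold.Instances.Sphere
import Mathlib.Geometry.Manifold.Diffeomorph
import Mathlib.Geometry.Manifold.PoincareConjecture
import Mathlib.Topology.Homotopy.Equiv
import Mathlib.AlgebraicTopology.FundamentalGroupoid.SimplyConnected
import Literature.Topology.FourManifolds.CircleSurgery
import Literature.Topology.FourManifolds.MappingTorus
import Literature.Topology.FourManifolds.ConnectedSum
import HarnessLib
import HarnessLib.Audit

-- provenance: harness21/H21/H21/Statements/SPC4/CappellShaneson.lean @ cfdc1fc (interim HEAD d8f2665); M5 mechanical rewrite
/-!
# SPC4 — Cappell–Shaneson homotopy 4-spheres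

Family `spc4` of the H21 statement library (trunk `FourManL`, outline
`H21/Outlines/FourManL.md` §3, file `Statements/SPC4/CappellShaneson.lean`): the target statement
**spc4.S18** "Cappell–Shaneson homotopy 4-spheres are diffeomorphic to `S⁴`", made statable by the
relational predicates `Literature.IsCappellShanesonSphereOf A X` / `Literature.IsCappellShanesonSphere X` of
`Prelude/FourManL/CircleSurgery.lean` (mapping torus of `A ∈ SL(3, ℤ)` acting on `T³`,
`det (A - 1) = ±1`, surgered along the section circle through the fixed point, either framing).

## Covered statement ids

* `spc4.S18` `CappellShanesonSpheresStandard` (OPEN CONJECTURE, `@[conjecture] def … : Prop`,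
  `[status: open]`): *every* Cappell–Shaneson sphere is diffeomorphic to `S⁴`. Infinite families
  are known to be standard (Akbulut–Kirby 1979/1985, Gompf 1991, Akbulut 2010, Gompf 2010,
  Kim–Yamada 2023, Iwaki 2025) but the general `A ∈ SL(3, ℤ)` is open — posed as a conjecture in
  Kim–Yamada 2023, §1, Conjecture 1 ("has remained open for 40 years") and Iwaki 2025, §1.1,
  Conjecture 1.2; Gompf 2010, §3: "The author does not presently know whether they cover all
  Cappell-Shaneson homotopy spheres". Its docstring starts `OPEN CONJECTURE —`, cites where the
  problem is posed and carries `[status: open]`: a registered open statement (CONVENTIONS §4),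
  not literature debt — no `_holds` is expected (verdict of the tenured prove-seat, re-verified
  2026-08-15 against the three sources). Name kept because of its users (barrier
  `CappellShanesonFamilyStandard`, `CappellShanesonHomotopySphereHolds`, theses `CsArithmeticWalk`,
  `GluckLasagna`).
* `spc4.S18` `nonempty_diffeomorph_sphere_four_of_isCappellShanesonSphereOf` (known theorem,
  named fact): for the standard family `Aₘ = cappellShanesonMatrix m`, `m ∈ ℤ`, and *both* framings,
  the Cappell–Shaneson sphere is diffeomorphic to `S⁴` (Akbulut, Ann. of Math. 171 (2010); Gompf,
  Algebr. Geom. Topol. 10 (2010)); and its special case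
  `nonempty_diffeomorph_sphere_four_of_isCappellShanesonSphereOf_akbulutKirby` (`m = 0`, proved from
  the family via `cappellShanesonMatrix_zero`).
* Known TOP / homotopy-theoretic facts for *all* Cappell–Shaneson spheres (named facts, D-0014):
  `nonempty_homotopyEquiv_sphere_four_of_isCappellShanesonSphere` (Cappell–Shaneson 1976, §2),
  `simplyConnectedSpace_of_isCappellShanesonSphere`,
  `nonempty_homeomorph_sphere_four_of_isCappellShanesonSphere` (+ Freedman 1982, Thm 1.6). Their
  decomposition and the PROVED glue between them live downstream (this file cannot import them):
  `CappellShanesonHomotopySphere.lean`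
  (`nonempty_homotopyEquiv_sphere_four_of_isCappellShanesonSphere_of` from `π₁ = 1`, `H₂ = 0` and
  `nonempty_homotopyEquiv_sphere_four_iff`;
  `nonempty_homeomorph_sphere_four_of_isCappellShanesonSphere_of` from the homotopy-sphere fact and
  Freedman's `nonempty_homeomorph_sphere_four`), `GluckTwistFreedmanSmooth.lean`
  (`…_of_freedman1982_smooth`) and `HomotopyS4SmoothCase.lean` (`…_of_thetaFour`).
* `exists_isCappellShanesonSphere`: Cappell–Shaneson spheres exist as closed smooth 4-manifolds
  (a corollary of the prelude's named fact `exists_isCappellShanesonSphereOf`).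
* Logical position of `CappellShanesonSpheresStandard` (OPEN; status 2025: Kim–Yamada 2023 §1,
  Iwaki 2025 §1): it is a special case of the smooth 4-dimensional Poincaré conjecture —
  `CappellShanesonSpheresStandard.of_nonemptyDiffeomorphSphere_four` (SPC4 in Mathlib's form
  `ContinuousMap.HomotopyEquiv.NonemptyDiffeomorphSphere M 4` + the Cappell–Shaneson
  homotopy-sphere fact ⟹ the statement) and its contrapositive
  `not_forall_nonemptyDiffeomorphSphere_four_of_not_cappellShanesonSpheresStandard`, both proved.
* `kimYamada2023_nonempty_diffeomorph_sphere_four_of_trace_mem_Icc` (named fact, Kim–Yamada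
  2023, Thm. B + Remark 1.1): Cappell–Shaneson spheres of matrices with `det (A - 1) = 1` and
  `-64 ≤ tr A ≤ 69` are diffeomorphic to `S⁴`; proved corollaries for `Aₘ`, `-66 ≤ m ≤ 67`, and
  for the Akbulut–Kirby matrix (`trace_coe_cappellShanesonMatrix : tr Aₘ = m + 2`).

## Mathlib status and design choices

* Mathlib has spheres `𝕊 n` as smooth manifolds (`Mathlib.Geometry.Manifold.Instances.Sphere`),
  diffeomorphisms `≃ₘ⟮_, _⟯`, homeomorphisms `≃ₜ`, homotopy equivalences `≃ₕ`
  (`ContinuousMap.HomotopyEquiv`), `SimplyConnectedSpace`, and the smooth Poincaré *statement*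
  `ContinuousMap.HomotopyEquiv.NonemptyDiffeomorphSphere` (`Mathlib.Geometry.Manifold.PoincareConjecture`);
  it has no mapping tori, surgery or Cappell–Shaneson spheres (searched `CappellShaneson`,
  `mapping torus`, `surgery`): those are `Literature.Topology.FourManifolds.IsCappellShanesonSphereOf`, `Literature.Topology.FourManifolds.IsCappellShanesonSphere`,
  `Literature.Topology.FourManifolds.cappellShanesonMatrix`, `Literature.Topology.FourManifolds.akbulutKirbyMatrix` from the prelude. Nothing new is *defined*
  here except the `Prop` `CappellShanesonSpheresStandard`.
* `namespace Literature.Topology.FourManifolds`, local notations `𝔼 n`, `𝕊 n` as in the other SPC4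
  files; "DIFF4 `X`" means
  `[TopologicalSpace X] [T2Space X] [SecondCountableTopology X] [ChartedSpace (𝔼 4) X]
  [IsManifold (𝓡 4) ∞ X] [CompactSpace X]`; universal statements are universe-polymorphic, the
  `Prop`-valued conjecture quantifies over `X : Type` (every closed manifold has a model in `Type`).
* No framing bookkeeping: `IsCappellShanesonSphereOf` quantifies over the tubular neighbourhood
  `ν` of the section circle, i.e. over both framings, and the cited theorems cover both framings of
  the whole family `Aₘ` (outline review #5).

Sources: S. Cappell, J. Shaneson, *Some new four-manifolds*, Ann. of Math. 104 (1976) 61–72;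
I. Aitchison, J. Rubinstein, *Fibered knots and involutions on homotopy spheres*, in
*Four-Manifold Theory*, Contemp. Math. 35 (1984) 1–74, §1;
S. Akbulut, R. Kirby, *An exotic involution of S⁴*, Topology 18 (1979) 75–81; S. Akbulut, R. Kirby,
*A potential smooth counterexample in dimension 4 to the Poincaré conjecture, the Schoenflies
conjecture, and the Andrews–Curtis conjecture*, Topology 24 (1985) 375–390; R. Gompf, *Killing the
Akbulut–Kirby 4-sphere, with relevance to the Andrews–Curtis and Schoenflies problems*, Topology 30
(1991) 97–115; S. Akbulut, *Cappell–Shaneson homotopy spheres are standard*, Ann. of Math. 171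
(2010) 2171–2175; R. Gompf, *More Cappell–Shaneson spheres are standard*, Algebr. Geom. Topol. 10
(2010) 1665–1681; M. Freedman, *The topology of four-dimensional manifolds*, J. Diff. Geom. 17
(1982) 357–453, Thm 1.6 (p. 371); M. H. Kim, S. Yamada, *Ideal classes and Cappell–Shaneson
homotopy 4-spheres*,
Kyungpook Math. J. 63 (2023) 373–411 (arXiv:1707.03860), Thm. B, Remark 1.1; K. Iwaki, *Infinite
families of standard Cappell–Shaneson homotopy 4-spheres*, Topology Appl. 366 (2025) 109293, §1.
-/

open scoped Manifold ContDiff Topology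
open Set

noncomputable section

namespace Literature.Topology.FourManifolds

universe u

/-- Local notation: `𝔼 n` is the model Euclidean space `EuclideanSpace ℝ (Fin n)`. -/
local notation "𝔼 " n:arg => EuclideanSpace ℝ (Fin n)

/-- Local notation: `𝕊 n` is the unit sphere in `EuclideanSpace ℝ (Fin (n + 1))`. -/
local notation "𝕊 " n:arg => (Metric.sphere (0 : EuclideanSpace ℝ (Fin (n + 1))) 1)

/-! ### The conjecture: all Cappell–Shaneson spheres are standard -/

/-- OPEN CONJECTURE — **spc4.S18**, **the Cappell–Shaneson conjecture** (every Cappell–Shaneson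
sphere is standard; general form). The statement that every Cappell–Shaneson homotopy 4-sphere
`X` (a closed smooth 4-manifold obtained from the mapping torus of some `A ∈ SL(3, ℤ)` with
`det (A - 1) = ±1` acting on `T³` by surgery on the section circle, either framing:
`Literature.Topology.FourManifolds.IsCappellShanesonSphere X`) is diffeomorphic to the standard
`S⁴`. POSED, not proved: M. H. Kim, S. Yamada, *Ideal classes and Cappell–Shaneson homotopy
4-spheres*, Kyungpook Math. J. 63 (2023) 373–411 (arXiv:1707.03860), §1 — "The following
folklore conjecture is a special case of the smooth 4-dimensional Poincaré conjecture and has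
remained open for 40 years. Conjecture 1. Every Cappell–Shaneson homotopy 4-sphere is
diffeomorphic to `S⁴`." [cite: KimYamada2023, §1, Conjecture 1 (posed as a folklore conjecture,
"has remained open for 40 years"; not a theorem)]; restated as an open conjecture in K. Iwaki,
Topology Appl. 366 (2025) 109293, §1.1, Conjecture 1.2 — "Every CS sphere is diffeomorphic to
`S⁴`" [cite: Iwaki2025, §1.1, Conjecture 1.2 (posed)]; and left open by R. Gompf, Algebr. Geom.
Topol. 10 (2010), §1 — "The work is still in progress, and may ultimately show that all
Cappell-Shaneson homotopy spheres are `S⁴`" — and §3, after Corollary 3.5 — "The author does not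
presently know whether they cover all Cappell-Shaneson homotopy spheres"
[cite: GompfAGT2010, §1; §3 (remark after Cor. 3.5)]. [status: open] — neither a proof nor a
disproof is in print. Sign convention: Kim–Yamada and Iwaki index the spheres by
*Cappell–Shaneson matrices* `det (A - I) = 1`; the tree's `IsCappellShanesonSphere` also allows
`det (A - 1) = -1`, which gives the same family of manifolds ("Since inverting `A` preserves
`X^ε_φ` but flips the sign of `det (A - I)`, we assume without loss of generality that the sign is
`+1`", Gompf 2010, §3), so the two formulations pose the same conjecture. What IS known is
recorded below and downstream as named facts / theorems: the family `Aₘ = cappellShanesonMatrix m`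
with both framings (Akbulut, Ann. of Math. 171 (2010); Gompf 2010, main theorem:
`nonempty_diffeomorph_sphere_four_of_isCappellShanesonSphereOf`), Gompf's Thm. 3.2 / Cor. 3.5
(`Literature/Barriers/SmoothPoincare4/CappellShanesonFamilyStandard.lean`), the trace range
`-64 ≤ tr A ≤ 69` (Kim–Yamada 2023, Thm. B:
`kimYamada2023_nonempty_diffeomorph_sphere_four_of_trace_mem_Icc`), and that the conjecture is a
special case of SPC4 (`CappellShanesonSpheresStandard.of_nonemptyDiffeomorphSphere_four`, proved).
Registered here as an OPEN statement (CONVENTIONS §4: an open conjecture is a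
`def … : Prop`, never asserted), not as named-fact debt: no `CappellShanesonSpheresStandard_holds`
is to be expected, and users keep the explicit hypothesis `(h : CappellShanesonSpheresStandard)`
or target it as a route item. The name is kept (no `…Conjecture` suffix) because
`Literature.Barriers.SmoothPoincare4.CappellShanesonFamilyStandard`
(`exoticCappellShanesonSphere_univ_iff`), `CappellShanesonHomotopySphereHolds.lean`
(`CappellShanesonSpheresStandard.of_smoothPoincareFour`) and the SPC4 theses `CsArithmeticWalk`
(assembly target) and `GluckLasagna` use it. -/
@[conjecture] def CappellShanesonSpheresStandard : Prop :=
  ∀ (X : Type) [TopologicalSpace X] [T2Space X] [SecondCountableTopology X]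
    [ChartedSpace (𝔼 4) X] [IsManifold (𝓡 4) ∞ X] [CompactSpace X],
    IsCappellShanesonSphere X → Nonempty (X ≃ₘ⟮𝓡 4, 𝓡 4⟯ ↥(𝕊 4))

/-! ### The standard family `Aₘ` (known theorems) -/

section Family

variable (X : Type u) [TopologicalSpace X] [T2Space X] [SecondCountableTopology X]
  [ChartedSpace (𝔼 4) X] [IsManifold (𝓡 4) ∞ X] [CompactSpace X]

/-- **spc4.S18** (Cappell–Shaneson homotopy 4-spheres are diffeomorphic to `S⁴`: the standard
family, both framings). For every `m ∈ ℤ`, every Cappell–Shaneson sphere of the matrix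
`Aₘ = !![0, 1, 0; 0, 1, 1; 1, 0, m + 1]` — with either of the two framings of the surgery, both of
which `IsCappellShanesonSphereOf` allows — is diffeomorphic to `S⁴`. History: `m = 0` with one
framing is Akbulut–Kirby (Topology 18 (1979); Topology 24 (1985), §1), the other framing of `m = 0`
is Gompf (Topology 30 (1991)); all `m` with the "easy" framing is Akbulut, *Cappell–Shaneson
homotopy spheres are standard*, Ann. of Math. 171 (2010); all `m` with both framings is Gompf,
*More Cappell–Shaneson spheres are standard*, Algebr. Geom. Topol. 10 (2010), main theorem. [cite: GompfAGT2010, main theorem] -/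
def nonempty_diffeomorph_sphere_four_of_isCappellShanesonSphereOf : Prop :=
  ∀ (m : ℤ) (h : IsCappellShanesonSphereOf (cappellShanesonMatrix m) X),
    Nonempty (X ≃ₘ⟮𝓡 4, 𝓡 4⟯ ↥(𝕊 4))

/-- **spc4.S18** (the Akbulut–Kirby spheres are standard). Every Cappell–Shaneson sphere of the
Akbulut–Kirby matrix `A₀ = !![0, 1, 0; 0, 1, 1; 1, 0, 1]` (either framing) is diffeomorphic to
`S⁴`. In print (R. Gompf, *More Cappell–Shaneson spheres are standard*, Algebr. Geom. Topol. 10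
(2010)): the *untwisted* framing is Akbulut–Kirby, *An exotic involution of `S⁴`*, Topology 18
(1979) [AK1] — §1: "The first progress in trivializing Cappell-Shaneson spheres was due to
Akbulut and Kirby [AK1] in 1979, showing via Kirby calculus that the example with `m = 0` and
untwisted framing is `S⁴`"; the *twisted* framing is Akbulut–Kirby, Topology 24 (1985) [AK2] ("an
elegant handle diagram of it with no 3-handles and only two 1-handles") followed by Gompf,
*Killing the Akbulut–Kirby 4-sphere*, Topology 30 (1991) [G1] ("This was then shown by the
author to be diffeomorphic to `S⁴` [G1]", §1), or, bypassing [AK2], [G1], Theorem 4.3 of loc. cit.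
("The two Cappell-Shaneson spheres given by the matrix `A₀` of Example 3.1(a) are diffeomorphic")
together with [AK1] — Examples 3.1(a): "both homotopy spheres arising from `A₀` are standard (by
[AK1] for the untwisted framing and Theorem 4.3 below, or [AK2] followed by [G1], in the twisted
case)", and after Theorem 4.3: "both manifolds are `S⁴` ([AK1] for the linear straightening of
`A₀` and [AK2], [G1] for the twisted straightening)". Position in the tree's DAG: the case
`m = 0` of `nonempty_diffeomorph_sphere_four_of_isCappellShanesonSphereOf`
(`cappellShanesonMatrix_zero : cappellShanesonMatrix 0 = A₀`); proved downstream relative to the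
two remaining leaves of that fact — the framed Theorem 2.1 `gompf2010_framedTwist` and the framed
[AK1] `akbulutKirby1979_linearStraightening` — as
`nonempty_diffeomorph_sphere_four_of_isCappellShanesonSphereOf_akbulutKirby_of_framed`
(`GompfFramedSpheres.lean`; Theorem 4.3 from `gompf2010_framedTwist` alone is
`gompf2010_thm43_of_framedTwist`, `GompfFramedTwistZero.lean`), and relative to Kim–Yamada's
trace range as `…_akbulutKirby_of_kimYamada` below; its discharge is that one line once the two
leaves are discharged (D-0026: no split, no new fact).
[cite: GompfAGT2010, Examples 3.1(a); Thm 4.3 and the remark following it; §1]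
[cite: AkbulutKirby1979, main theorem (Σ ≅ S⁴)] [cite: Gompf1991Killing, main theorem] -/
def nonempty_diffeomorph_sphere_four_of_isCappellShanesonSphereOf_akbulutKirby : Prop :=
  ∀ (h : IsCappellShanesonSphereOf akbulutKirbyMatrix X),
    Nonempty (X ≃ₘ⟮𝓡 4, 𝓡 4⟯ ↥(𝕊 4))

/- interim proof relied on results that are now named facts (D-0014); demoted to a fact by the M5 import, proof preserved:
:=
  nonempty_diffeomorph_sphere_four_of_isCappellShanesonSphereOf X 0 (cappellShanesonMatrix_zero ▸ h)
-/

end Family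

/-! ### Known topological facts for all Cappell–Shaneson spheres -/

section Topological

variable (X : Type u) [TopologicalSpace X] [T2Space X] [SecondCountableTopology X]
  [ChartedSpace (𝔼 4) X] [IsManifold (𝓡 4) ∞ X] [CompactSpace X]

/-- **Cappell–Shaneson spheres are homotopy spheres.** Every Cappell–Shaneson sphere `X` is
homotopy equivalent to `S⁴`: the mapping torus `T_A` of `A ∈ SL(3, ℤ)` has `π₁` the semidirect
product `ℤ³ ⋊_A ℤ`, killed by surgery on the section circle exactly when `A - 1` is invertible over
`ℤ`, i.e. `det (A - 1) = ±1`; the same condition makes `T_A` a homology `S¹ × S³`, so the surgered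
manifold is a simply connected homology 4-sphere, hence a homotopy 4-sphere (Cappell–Shaneson,
*Some new four-manifolds*, Ann. of Math. 104 (1976), §2; restated for `det (B - 1) = ±1`, the
*linear* `φ_B` and the section circle, with `S² × D²` "glued in by some diffeomorphism of `S² × S¹`,
to obtain a homotopy 4-sphere", in Aitchison–Rubinstein, Contemp. Math. 35 (1984), §1, and as
"`X^ε_φ` is a homotopy 4-sphere if and only if `det (A - I) = ±1`" (both framings `ε`) in Gompf,
Algebr. Geom. Topol. 10 (2010), §2). The binders are only
`[TopologicalSpace X] [ChartedSpace (𝔼 4) X]`: Hausdorffness, second countability and compactness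
of a Cappell–Shaneson sphere are proved
downstream (`IsCappellShanesonSphere.t2Space` etc., `CappellShanesonHomotopySphere.lean`), where
this fact is reduced, with proved glue, to `simplyConnectedSpace_of_isCappellShanesonSphere`,
`isZero_singularHomologyZ_two_of_isCappellShanesonSphere` and
`nonempty_homotopyEquiv_sphere_four_iff`. [cite: CappellShanesonAnnals1976, §2] -/
def nonempty_homotopyEquiv_sphere_four_of_isCappellShanesonSphere : Prop :=
  ∀ (h : IsCappellShanesonSphere X),
    Nonempty (ContinuousMap.HomotopyEquiv X ↥(𝕊 4))

/-- **Cappell–Shaneson spheres are simply connected** (Cappell–Shaneson, Ann. of Math. 104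
(1976), §2: surgery on the section circle kills `π₁ (T_A) = ℤ³ ⋊_A ℤ` since `det (A - 1) = ±1`;
also a consequence of `nonempty_homotopyEquiv_sphere_four_of_isCappellShanesonSphere`). [cite: CappellShanesonAnnals1976, §2] -/
def simplyConnectedSpace_of_isCappellShanesonSphere : Prop :=
  ∀ (h : IsCappellShanesonSphere X),
    SimplyConnectedSpace X

/-- **Cappell–Shaneson spheres are homeomorphic to `S⁴`** (Cappell–Shaneson 1976 + Freedman 1982).
Every Cappell–Shaneson sphere `X` is a closed homotopy 4-sphere
(`nonempty_homotopyEquiv_sphere_four_of_isCappellShanesonSphere`: Cappell–Shaneson, Ann. of Math.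
104 (1976), §2; Aitchison–Rubinstein 1984, §1; Gompf 2010, §2), hence homeomorphic to `S⁴` by
Freedman's topological 4-dimensional Poincaré theorem, J. Differential Geom. 17 (1982), Thm 1.6
(p. 371): "If `Σ⁴` is a topological 4-manifold homotopy equivalent to the 4-sphere `S⁴`, then `Σ⁴`
is homeomorphic to `S⁴`" (the tree's named fact `nonempty_homeomorph_sphere_four`, `spc4.S04`).
This is a COROLLARY NODE of the fact DAG, not an independent leaf: the glue is proved downstream
as `nonempty_homeomorph_sphere_four_of_isCappellShanesonSphere_of`
(`CappellShanesonHomotopySphere.lean`, from the homotopy-sphere fact at universe `0` and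
`nonempty_homeomorph_sphere_four.{0}`; the
universe reduction and `T2Space`/`SecondCountableTopology` of `X` are proved there), with the
alternatives `…_of_freedman1982_smooth` (`GluckTwistFreedmanSmooth.lean`, over Freedman's Cor. 1.2
for smooth `V`) and `…_of_thetaFour` (`HomotopyS4SmoothCase.lean`, over `Θ₄ = 0` and Thm 1.3); its
discharge is that one line once those leaves are discharged (D-0026: no split, no new fact).
[cite: CappellShanesonAnnals1976, §2] [cite: FreedmanJDG1982, Thm 1.6] -/
def nonempty_homeomorph_sphere_four_of_isCappellShanesonSphere : Prop :=
  ∀ (h : IsCappellShanesonSphere X),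
    Nonempty (X ≃ₜ ↥(𝕊 4))

end Topological

/-! ### Existence -/

/-- **Cappell–Shaneson spheres exist** as closed smooth 4-manifolds: the Akbulut–Kirby matrix
`A₀` satisfies `det (A₀ - 1) = 1`, so the prelude's existence theorem
`Literature.Topology.FourManifolds.exists_isCappellShanesonSphereOf` applies (Cappell–Shaneson, Ann. of Math. 104 (1976), §2;
Akbulut–Kirby, Topology 24 (1985), §1). In particular `CappellShanesonSpheresStandard` is not
vacuous. Relies on: the named fact
`Literature.Topology.FourManifolds.exists_isCappellShanesonSphereOf`. [folklore] -/
def exists_isCappellShanesonSphere : Prop :=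
  ∃ (X : Type) (_ : TopologicalSpace X) (_ : T2Space X) (_ : SecondCountableTopology X)
      (_ : ChartedSpace (𝔼 4) X) (_ : IsManifold (𝓡 4) ∞ X) (_ : CompactSpace X),
      IsCappellShanesonSphere X

/- interim proof relied on results that are now named facts (D-0014); demoted to a fact by the M5 import, proof preserved:
:= by
  obtain ⟨X, _, _, _, _, _, _, hX⟩ := exists_isCappellShanesonSphereOf_akbulutKirbyMatrix
  exact ⟨X, ‹_›, ‹_›, ‹_›, ‹_›, ‹_›, ‹_›, akbulutKirbyMatrix, hX⟩
-/

/-! ### Logical position: a special case of the smooth 4-dimensional Poincaré conjecture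

`CappellShanesonSpheresStandard` is OPEN (status 2025): Kim–Yamada, *Ideal classes and
Cappell–Shaneson homotopy 4-spheres*, Kyungpook Math. J. 63 (2023), §1 — "The following folklore
conjecture [every Cappell–Shaneson homotopy 4-sphere is diffeomorphic to `S⁴`] is a special case of
the smooth 4-dimensional Poincaré conjecture and has remained open for 40 years"; Gompf 2010, §3
(after Cor. 3.5) — "The author does not presently know whether they cover all Cappell-Shaneson
homotopy spheres"; Iwaki, Topology Appl. 366 (2025) — further infinite families, general case
open. What the literature HAS decided is recorded as named facts (the family `Aₘ` above; Gompf's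
Thm. 3.2 / Cor. 3.5 in `Literature/Barriers/SmoothPoincare4/CappellShanesonFamilyStandard.lean`;
Kim–Yamada's trace range below). The two theorems of this section are the formal content of
"special case": they are proved outright. -/

section SpecialCase

/-- **The Cappell–Shaneson conjecture is a special case of SPC4.** If every Hausdorff, second
countable smooth 4-manifold homotopy equivalent to `S⁴` is diffeomorphic to `S⁴` — the smooth
4-dimensional Poincaré conjecture in Mathlib's form
`ContinuousMap.HomotopyEquiv.NonemptyDiffeomorphSphere M 4`, closed over all `M : Type` (the
summit statement `SmoothPoincare4` unfolds to literally this hypothesis `hSPC4`) — then, granted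
Cappell–Shaneson's theorem that their surgered mapping tori are homotopy 4-spheres (the named fact
`nonempty_homotopyEquiv_sphere_four_of_isCappellShanesonSphere`, hypothesis `hCS`, D-0014), every
Cappell–Shaneson sphere is diffeomorphic to `S⁴`. (Kim–Yamada 2023, §1: the Cappell–Shaneson
conjecture "is a special case of the smooth 4-dimensional Poincaré conjecture"; Gompf 2010, §1.)
[cite: KimYamada2023, §1] -/
theorem CappellShanesonSpheresStandard.of_nonemptyDiffeomorphSphere_four
    (hSPC4 : ∀ (M : Type) [TopologicalSpace M] [T2Space M] [SecondCountableTopology M],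
      ContinuousMap.HomotopyEquiv.NonemptyDiffeomorphSphere M 4)
    (hCS : ∀ (X : Type) [TopologicalSpace X] [T2Space X] [SecondCountableTopology X]
      [ChartedSpace (𝔼 4) X] [IsManifold (𝓡 4) ∞ X] [CompactSpace X],
      nonempty_homotopyEquiv_sphere_four_of_isCappellShanesonSphere X) :
    CappellShanesonSpheresStandard := by
  intro X _ _ _ _ _ _ hX
  obtain ⟨e⟩ := hCS X hX
  exact hSPC4 X ‹_› ‹_› e

/-- **An exotic Cappell–Shaneson sphere would refute SPC4** (contrapositive of
`CappellShanesonSpheresStandard.of_nonemptyDiffeomorphSphere_four`): granted the Cappell–Shaneson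
homotopy-sphere fact `hCS`, the failure of `CappellShanesonSpheresStandard` — i.e. some
Cappell–Shaneson sphere not diffeomorphic to `S⁴`, "the most notable, potential counterexamples of
the smooth 4-dimensional Poincaré conjecture" (Kim–Yamada 2023, §1) — negates the smooth
4-dimensional Poincaré conjecture in Mathlib's form. [cite: KimYamada2023, §1] -/
theorem not_forall_nonemptyDiffeomorphSphere_four_of_not_cappellShanesonSpheresStandard
    (hCS : ∀ (X : Type) [TopologicalSpace X] [T2Space X] [SecondCountableTopology X]
      [ChartedSpace (𝔼 4) X] [IsManifold (𝓡 4) ∞ X] [CompactSpace X],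
      nonempty_homotopyEquiv_sphere_four_of_isCappellShanesonSphere X)
    (h : ¬ CappellShanesonSpheresStandard) :
    ¬ ∀ (M : Type) [TopologicalSpace M] [T2Space M] [SecondCountableTopology M],
      ContinuousMap.HomotopyEquiv.NonemptyDiffeomorphSphere M 4 :=
  fun hSPC4 => h (CappellShanesonSpheresStandard.of_nonemptyDiffeomorphSphere_four hSPC4 hCS)

end SpecialCase

/-! ### The trace range `-64 ≤ tr A ≤ 69` (Kim–Yamada 2023, known theorem) -/

section TraceRange

/-- **Kim–Yamada 2023, Theorem B with Remark 1.1 (named fact): Cappell–Shaneson spheres of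
matrices with trace in `[-64, 69]` are standard.** Setting (§1.1): a *Cappell–Shaneson matrix* is
`A ∈ SL(3, ℤ)` with `det (A - I) = 1` (Gompf's sign normalisation; the tree's
`IsCappellShanesonSphereOf` also allows `det (A - 1) = -1`, which is NOT covered here), and
`Σ_A^ε`, `ε ∈ ℤ/2`, are its two Cappell–Shaneson spheres (both framings — exactly what
`IsCappellShanesonSphereOf A X` ranges over). Theorem B (§1.2): Gompf's conjecture — every
Cappell–Shaneson matrix is Gompf equivalent to `A₀` (Gompf 2010; the paper's second conjecture) —
"is true for trace `n` if `-64 ≤ n ≤ 69`"; Remark 1.1: if Gompf's conjecture is true for trace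
`n`, then the Cappell–Shaneson conjecture (`Σ_A^ε ≅ S⁴` for every `ε`) "is true for every matrix
with trace `n`"; abstract: "We confirm Gompf conjecture for the special cases that
`-64 ≤ trace ≤ 69` and corresponding Cappell-Shaneson homotopy 4-spheres are diffeomorphic to the
standard 4-sphere." (Locators as in arXiv:1707.03860, whose main results are lettered A–D as in the
journal version, Kyungpook Math. J. 63 (2023) 373–411, cf. Iwaki 2025 citing "Corollary D". The
proof runs through Gompf 2010, Thm. 2.1/§3, the Latimer–MacDuffee–Taussky correspondence between
similarity classes of trace-`n` matrices and the ideal class monoid of `ℤ[Θₙ]`, and MAGMA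
computations; Iwaki, Topology Appl. 366 (2025), Thm. 1.5 and Cor. 1.6, lists 146 triples
`(c, p, n₀)`, 145 of them new, each giving an infinite family `X_{c,p,p²k+n₀}` of standard
Cappell–Shaneson spheres.) Users take
`(h : kimYamada2023_nonempty_diffeomorph_sphere_four_of_trace_mem_Icc)`.
[cite: KimYamada2023, Thm. B and Remark 1.1] -/
def kimYamada2023_nonempty_diffeomorph_sphere_four_of_trace_mem_Icc : Prop :=
  ∀ (A : Matrix.SpecialLinearGroup (Fin 3) ℤ) (hA : (A.1 - 1).det = 1)
    (htr : Matrix.trace A.1 ∈ Set.Icc (-64 : ℤ) 69)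
    (X : Type u) [TopologicalSpace X] [T2Space X] [SecondCountableTopology X]
    [ChartedSpace (𝔼 4) X] [IsManifold (𝓡 4) ∞ X] [CompactSpace X],
    IsCappellShanesonSphereOf A X → Nonempty (X ≃ₘ⟮𝓡 4, 𝓡 4⟯ ↥(𝕊 4))

/-- The trace of the Cappell–Shaneson family matrix `Aₘ = !![0, 1, 0; 0, 1, 1; 1, 0, m + 1]` is
`m + 2` (Kim–Yamada 2023, §1.1: `Aₙ = X_{1,1,n+2}`). [cite: KimYamada2023, §1.1] -/
@[simp] theorem trace_coe_cappellShanesonMatrix (m : ℤ) :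
    Matrix.trace (cappellShanesonMatrix m : Matrix (Fin 3) (Fin 3) ℤ) = m + 2 := by
  simp only [coe_cappellShanesonMatrix, Matrix.trace_fin_three, Fin.isValue, Matrix.of_apply,
    Matrix.cons_val', Matrix.cons_val_zero, Matrix.cons_val_fin_one, Matrix.cons_val_one, zero_add,
    Matrix.cons_val]
  ring

/-- The Akbulut–Kirby matrix `A₀` has trace `2`. [folklore] -/
@[simp] theorem trace_coe_akbulutKirbyMatrix :
    Matrix.trace (akbulutKirbyMatrix : Matrix (Fin 3) (Fin 3) ℤ) = 2 := by
  decide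

variable (X : Type u) [TopologicalSpace X] [T2Space X] [SecondCountableTopology X]
  [ChartedSpace (𝔼 4) X] [IsManifold (𝓡 4) ∞ X] [CompactSpace X]

/-- **Kim–Yamada's trace range covers the members `-66 ≤ m ≤ 67` of the family `Aₘ`** (both
framings): `det (Aₘ - 1) = 1` and `tr Aₘ = m + 2 ∈ [-64, 69]`. In particular the fact is not
vacuous on the tree's objects. [cite: KimYamada2023, Thm. B and Remark 1.1] -/
theorem nonempty_diffeomorph_sphere_four_of_isCappellShanesonSphereOf_of_kimYamada
    (h : kimYamada2023_nonempty_diffeomorph_sphere_four_of_trace_mem_Icc.{u}) (m : ℤ)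
    (hm : m ∈ Set.Icc (-66 : ℤ) 67) (hX : IsCappellShanesonSphereOf (cappellShanesonMatrix m) X) :
    Nonempty (X ≃ₘ⟮𝓡 4, 𝓡 4⟯ ↥(𝕊 4)) := by
  refine h (cappellShanesonMatrix m) (det_cappellShanesonMatrix_sub_one m) ?_ X hX
  simp only [trace_coe_cappellShanesonMatrix, Set.mem_Icc] at hm ⊢
  omega

/-- **The Akbulut–Kirby sphere is standard, from Kim–Yamada's trace range** (`A₀`: trace `2`,
`det (A₀ - 1) = 1`; historically Akbulut–Kirby 1979 and Gompf 1991): the named fact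
`nonempty_diffeomorph_sphere_four_of_isCappellShanesonSphereOf_akbulutKirby X` follows.
[cite: KimYamada2023, Thm. B and Remark 1.1] -/
theorem nonempty_diffeomorph_sphere_four_of_isCappellShanesonSphereOf_akbulutKirby_of_kimYamada
    (h : kimYamada2023_nonempty_diffeomorph_sphere_four_of_trace_mem_Icc.{u}) :
    nonempty_diffeomorph_sphere_four_of_isCappellShanesonSphereOf_akbulutKirby X := by
  intro hX
  refine h akbulutKirbyMatrix det_akbulutKirbyMatrix_sub_one ?_ X hX
  simp only [trace_coe_akbulutKirbyMatrix, Set.mem_Icc]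
  omega

end TraceRange

end Literature.Topology.FourManifolds
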